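import Summits.BirchSwinnertonDyer.BirchSwinnertonDyer.Theorems.Rank1ResidualX9Defs
import Literature.NumberTheory.EllipticCurves.Rank1Residual.EulerLossCarrier
import HarnessLib
import HarnessLib.Audit

/-!
# ES-C7 «every §17.13 Kato package is Euler-PRIMITIVE at `(p)` on class X9»: `μ(𝐇¹/Z) = 0` for every
# package at every X9 pair — the `δ = 0` coordinate of the Euler-system lens's `(δ, e, c)` chart
# (OPEN; nothing asserted)

HONEST FRAMING (cell `bsd-f3-mu`, D-0131 (3) FRONTIER TIER, HOME `run/shared/lean/pub/bsd-f3-mu/`).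
TYPER's filing of the `-es` lens's generation-6 candidate ES-C7 (MEMO-es §27, `HOME/es/EulerLossChartExact.lean`
= «Sketch7», sha16 4b5b6c8384c6f496, rc 0, 0 sorry; refuter `-ref1`: SURVIVES (self-BC7 2/2 CLEAN,
`es/bc7_verdicts7.txt` f2b96bbbfd84871b; no kill in the ninth/tenth passes); refuter `-ref2` row es-§27
(REF2-LITMAP): OPEN as a class-wide statement on X9 — NOT in print, not refuted in print, implied by
`μ^an = 0`; falsifier `es/falsifier_c7.out` 58f5e82ff8318060 on X9-MU-TABLE-v1 361f587418fce70d: decided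
TRUE on 790/790 census class pairs (624 5S4 + 130 5Ns + 36 7Ns) and 834/848 X9 rows (every certified row:
`μ^an = 0` ⟹ `δ_Z = 0` for every package, by the kernel edge (c7a), NO F1, NO BCS), 0 refuting, 14
undecided).  A pure CONJECTURE LEAF over the Literature carrier `Rank1Residual.EulerLossZeroAt`
(`Rank1Residual/EulerLossCarrier.lean`); kernel edges in `EulerLossZeroEdges.lean`.

THE CHART (MEMO-es §9, §27; Kato §17.13).  Per package `μ(L_p) = δ + e + c` with `δ = μ(𝐇¹/Z)` the Euler
loss, `e = μ(P/loc 𝐇¹)`, `c = 0` (Prop. 17.11), and EXACTLY `μ(X) + δ = μ(Λ/(G₁)) + μ(X₀)`,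
`k + δ = μ(X₀)` (tree `SmallImageMu.mu_add_eulerLoss_eq`, `SmallImageMu.muDefect_add_eulerLoss_eq`).  ES-C7 is
«`δ = 0`»; ES-C6 (`MuLeFineMuOnClassX9`) is «`e = 0`»; and on X9, modulo F1 and a modularity witness,
`AnalyticMuZeroOnClassX9 ⟺ ES-C7 ∧ ES-C6` (edges (c7a)/(c7b)/(c7↔)) — the lens's answer to the cell's
search question: the power of `p` lost by the Euler-system machinery at non-surjective image is `δ_Z`
EXACTLY, and `μ^an = 0` iff nothing is lost and `μ` is fine.  ES-C7 ⟹ ES-C2 (`EulerPrimitiveOnClassX9`)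
modulo F1_ζ + Kato Thm. 12.4 (edge (c7c)); on an ES-C7 pair Kato's divisibility (`k ≤ 0`, crux 20547)
and statement (A) (`μ(X₀) = 0`) coincide package by package
(`muDefect_nonpos_iff_fineMu_eq_zero_of_eulerLoss_eq_zero`).
PARTITION currency unchanged: X9 790 = 130 (5Ns) + 36 (7Ns) + 624 (5S4) (+58 r ≥ 2); X10b 883 = 610 + 273;
this node closes no class; beyond-print theorem: NO.

References: [Kato2004Asterisque] Thm. 12.4–12.6 (pp. 221–222), Thm. 13.4 (p. 226), Prop. 17.11, §17.13
(pp. 279–280); [Wuthrich2006] pp. 715–717; [Delbourgo2008] Thm. 3.8 (ii) (p. 71); [GreenbergLNM1716]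
Conj. 1.11; HOME MEMO-es.md §9, §27, es/EulerLossChartExact.lean, REF2-LITMAP.md row es-§27,
CANDIDATES.md §1 row 26.
-/

-- the summit and its single problem are both named `BirchSwinnertonDyer` (registry layout D-0017)
set_option linter.dupNamespace false

noncomputable section

open scoped Classical

open WeierstrassCurve Literature.NumberTheory.EllipticCurves
  Summit.BirchSwinnertonDyer.BirchSwinnertonDyer.Rank1Residual
open Literature.NumberTheory.EllipticCurves.Rank1Residual (EulerLossZeroAt)

namespace Summit.BirchSwinnertonDyer.Rank1Residual.SmallImageMu

/-- **ES-C7 — Euler-primitivity of Kato's zeta module on class X9, PACKAGE form (OPEN off the certified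
census; cell candidate; nothing asserted).**  At every X9 pair (`p ≥ 5` good ordinary, `E[p]` irreducible,
`ρ̄_{E,p}` not surjective, non-CM): `Rank1Residual.EulerLossZeroAt W p`, i.e. for all cyclotomic data,
every newform and EVERY §17.13 package `K`, `μ(𝐇¹/K.Z) = 0` (`δ = 0`).  Stronger than ES-C2
`EulerPrimitiveOnClassX9` (some GENUINE class `∉ p𝐇¹`; implied via the Thm. 12.6 span clause and
`𝐇¹ ≅ Λ`); with ES-C6 it is EXACTLY the cell's analytic target per X9 pair.  In print at surjective image
(Kato Thm. 12.5 (4) under (12.5.2), Thm. 13.4: `Z(f,T) ⊂ 𝐇¹(T)` with lengths controlled at every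
height-one prime); on X9 the image index enters `Z ⊂ 𝐇¹` (Thm. 12.6: finite index, `μ`-part not printed)
— the lens's «what power of `p` is lost».  Verbatim the audited `HOME/es/EulerLossChartExact.lean` §5.
[cite: Kato2004Asterisque, Thm. 12.5 (4) (pp. 221–222), Thm. 12.6 (p. 222), Thm. 13.4 (p. 226), §17.13 (pp. 279–280) — OPEN on X9]
[cite: Wuthrich2006, pp. 715–717 (Thm. 2, Lemma 3, Prop. 7: `char Y ∣ pᵗ · ind(c_∞)`; `t` open off (12.5.2))] -/
@[conjecture] def EulerLossZeroOnClassX9 : Prop :=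
  ∀ (W : WeierstrassCurve ℚ) [W.IsElliptic] [W.IsGloballyMinimal] (p : ℕ) [Fact p.Prime]
    [ContinuousSMul ℤ_[p] (W.tateModule p)],
    ClassX9 W p → EulerLossZeroAt W p

end Summit.BirchSwinnertonDyer.Rank1Residual.SmallImageMu

end
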